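/-
Copyright (c) 2026. All rights reserved.
Released under Apache 2.0 license as described in the file LICENSE.
Authors: abc-iut cell, statement-typer seat abc-iut-L4-t3 (wave 1).
-/
import Literature.AnabelianGeometry.AbsoluteAnabelian.DiagramMorphismPathIso
import Literature.AnabelianGeometry.AbsoluteAnabelian.DiagramUniversalFamilies

/-!
# 1-morphisms of diagrams of categories lying over a functor of the bases: compatibility with the universal families
# ([AbsTopIII] Def. 3.5 (ii), (v); toolkit)

S. Mochizuki, *Topics in Absolute Anabelian Geometry III*, Def. 3.5 (ii), (v) pp. 75–76 (manuscript
`paper:url-5493eb38cbb7`, bib key `MochizukiAbsTopIII2015`).  Continuation of abc-iut-L4-t5's toolkit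
(`DiagramLifts`, `DiagramUniversalFamilies`: the universal family of homotopies `univFamily O W` of a diagram of
categories `𝒟` with structure functors `(N, μ)` over `𝒞` (`OverData`), fully faithful on the vertex set `W`).

Given a 1-morphism of diagrams of categories `Ψ : 𝒟 → 𝒟'` (Def. 3.5 (v): `Ψ_v`, `Ψ_e`, abc-iut-L4-t2's
`OneMorphism`) over a morphism of oriented graphs `F`, structure functors `O` on `𝒟` over `𝒞` and `O'` on `𝒟'` over
`𝒞'`, and a functor `Φ : 𝒞 ⥤ 𝒞'` of the bases, we say that `Ψ` LIES OVER `Φ` (`OneMorphism.OverHom`) when there are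
isomorphisms `θ_v : Ψ_v ⋙ N'_{F v} ≅ N_v ⋙ Φ` forming, with `Ψ_e`, `μ_e`, `μ'_{F e}`, a commutative PRISM at every edge.
Then:

* component formulas (plain and heterogeneous) for abc-iut-f-102's `OneMorphism.pathIso` — the isomorphisms
  `Ψ_{[γ]} : Ψ_a ⋙ 𝒟'_{F[γ]} ≅ 𝒟_{[γ]} ⋙ Ψ_b` along paths composed from the `Ψ_e` (`DiagramMorphismPathIso.lean`);
* `OverHom.pathPrism` — the prisms compose along paths;
* (continued in `DiagramOverMorphismsFamilies.lean`: `lift_compat`, `univFamily_η_compat`, `compatibleWithRestrict` — the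
  homotopies of the universal families COMMUTE with the `Ψ_{[γ]}`, hence `Ψ` is compatible, in the sense of Def. 3.5 (v),
  with the restrictions of the two universal families to any common saturated set of pairs).

BOOKKEEPING NOTE. The path functors satisfy `𝒟_{[σ∘γ]} = 𝒟_{[σ]} ∘ 𝒟_{[γ]}` only propositionally and the composites
`(F ⋙ G).obj x = G.obj (F.obj x)` only definitionally, so `rw`/`simp` do not cross these seams; all bookkeeping is done
by heterogeneous equalities (`heq_comp`, `map_heq`, `app_heq`, `…_heq` component formulas) and by ABSTRACT algebra
lemmas over variable objects (`prism_cons_calc`, `lift_compat_calc`, `η_compat_calc`) applied by unification.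

This is the two-diagram form of the invariance worked out for the shift self-equivalences in
`LogFrobeniusTelecoreShiftCompat.lean` (this seat); consumer: the Def 3.5 (v) compatibility of the panalocalization
morphism `D⊚ → D✠` with `𝔗_{An•}`, `ℋ_{An•}` ([AbsTopIII] Cor 5.5 (vi)).  Pure category theory; no claim of the paper
is asserted; nothing here bears on [IUTchIII] Cor. 3.12.
-/

noncomputable section

namespace Literature.AnabelianGeometry.AbsoluteAnabelian

open _root_.CategoryTheory _root_.Quiver

universe v u w

namespace DiagramOfCategories

variable {V : Type w} [Quiver.{v} V] {V' : Type w} [Quiver.{v} V']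
  {D : DiagramOfCategories.{v, u, w} V} {D' : DiagramOfCategories.{v, u, w} V'} {F : V ⥤q V'}

/-! ### Bookkeeping (heterogeneous equalities) -/

/-- an `eqToHom` is heterogeneously an identity. [folklore] -/
private theorem heq_id_of_eq {C : Type u} [Category.{v} C] {X Y Z : C} (h : X = Y) (hX : X = Z) :
    HEq (eqToHom h) (𝟙 Z) := by
  subst hX; subst h; rfl

/-- a functor respects heterogeneous equality of morphisms between equal objects. [folklore] -/
private theorem map_heq {A B : Type u} [Category.{v} A] [Category.{v} B] (G : A ⥤ B) {X Y X' Y' : A} (hX : X = X')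
    (hY : Y = Y') {f : X ⟶ Y} {f' : X' ⟶ Y'} (h : HEq f f') : HEq (G.map f) (G.map f') := by
  subst hX hY; cases h; rfl

/-- components of a natural transformation at equal objects are heterogeneously equal. [folklore] -/
private theorem app_heq {A B : Type u} [Category.{v} A] [Category.{v} B] {G H : A ⥤ B} (α : G ⟶ H) {x x' : A}
    (h : x = x') : HEq (α.app x) (α.app x') := by
  subst h; rfl

/-- structure isomorphisms along an extended path, heterogeneously (abc-iut-L4-t5's `pathIso_cons_app` without the
`eqToHom`). [folklore] -/
private theorem OverData.pathIso_cons_heq {V₀ : Type w} [Quiver.{v} V₀] {D₀ : DiagramOfCategories.{v, u, w} V₀}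
    {C : Type u} [Category.{v} C] (O : D₀.OverData C) {a b c : V₀} (p : Path a b) (e : b ⟶ c) (x : D₀.obj a) :
    HEq ((O.pathIso (p.cons e)).hom.app x) ((O.μ e).hom.app ((D₀.pathFunctor p).obj x) ≫ (O.pathIso p).hom.app x) := by
  rw [O.pathIso_cons_app]
  simp only [eqToHom_comp_heq_iff]
  rfl

/-- structure isomorphisms along the empty path are identities, heterogeneously. [folklore] -/
private theorem OverData.pathIso_nil_heq {V₀ : Type w} [Quiver.{v} V₀] {D₀ : DiagramOfCategories.{v, u, w} V₀}
    {C : Type u} [Category.{v} C] (O : D₀.OverData C) (a : V₀) (x : D₀.obj a) :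
    HEq ((O.pathIso (Path.nil : Path a a)).hom.app x) (𝟙 ((O.N a).obj x)) := by
  rw [O.pathIso_nil_app]
  exact heq_id_of_eq _ (by simp only [Functor.comp_obj, pathFunctor_nil, Functor.id_obj])

/-- the induction step of `OverHom.pathPrism`, as abstract category algebra over variable objects (so that it applies
by unification across the definitional seams `(F ⋙ G).obj x = G.obj (F.obj x)` of the concrete composites). [folklore] -/
private theorem prism_cons_calc {C₀ : Type u} [Category.{v} C₀] {X₀ X₁ X₂ X₃ X₄ X₅ Y₁ Y₂ Y₃ : C₀}
    {A : X₀ ⟶ X₁} {B : X₁ ⟶ X₂} {Cc : X₂ ⟶ X₃} {D0 : X₃ ⟶ X₄} {E : X₄ ⟶ X₅} {μ' : X₁ ⟶ Y₁} {θb : Y₁ ⟶ X₄}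
    {μ₀ : X₀ ⟶ Y₂} {N : Y₂ ⟶ Y₁} {P : Y₂ ⟶ Y₃} {T : Y₃ ⟶ X₅}
    (hp : B ≫ Cc ≫ D0 = μ' ≫ θb) (hn : A ≫ μ' = μ₀ ≫ N) (ih : N ≫ θb ≫ E = P ≫ T) :
    (A ≫ B) ≫ Cc ≫ D0 ≫ E = (μ₀ ≫ P) ≫ T := by
  rw [Category.assoc, reassoc_of% hp, reassoc_of% hn, ih, Category.assoc]

/-! ### The isomorphisms `Ψ_{[γ]}` of a 1-morphism along paths -/

namespace OneMorphism

variable (Ψ : OneMorphism F D D')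

/-! `OneMorphism.pathIso` — `Ψ_{[γ]} : Ψ_a ⋙ 𝒟'_{F[γ]} ≅ 𝒟_{[γ]} ⋙ Ψ_b`, composed from the `Ψ_e` as prescribed by
`OneMorphism.CompatibleWith` — is abc-iut-f-102's (`DiagramMorphismPathIso.lean`); here: its component formulas. -/

/-- components of `Ψ_{[γ]}` on the empty path: an `eqToHom`. [cite: MochizukiAbsTopIII2015, Definition 3.5 (v) p.76] -/
theorem pathIso_nil_hom_app (a : V) (x : D.obj a) :
    (Ψ.pathIso (Path.nil : Path a a)).hom.app x =
      eqToHom (show (Ψ.app a ⋙ D'.pathFunctor (F.mapPath (Path.nil : Path a a))).obj x =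
          (D.pathFunctor (Path.nil : Path a a) ⋙ Ψ.app a).obj x by
        rw [Prefunctor.mapPath_nil, pathFunctor_nil, pathFunctor_nil]; rfl) := by
  rw [pathIso_nil]
  simp only [Iso.trans_hom, eqToIso.hom, NatTrans.comp_app, eqToHom_app, Iso.symm_hom,
    Functor.rightUnitor_hom_app, Functor.leftUnitor_inv_app]
  erw [Category.id_comp, Category.id_comp, eqToHom_trans]

/-- components of `Ψ_{[γ]}` on an extended path: `𝒟'_{F e}(Ψ_{[γ]}) ≫ Ψ_e`, up to `eqToHom`s.
[cite: MochizukiAbsTopIII2015, Definition 3.5 (v) p.76] -/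
theorem pathIso_cons_hom_app {a b c : V} (p : Path a b) (e : b ⟶ c) (x : D.obj a) :
    (Ψ.pathIso (p.cons e)).hom.app x =
      eqToHom (show (Ψ.app a ⋙ D'.pathFunctor (F.mapPath (p.cons e))).obj x =
          (D'.map (F.map e)).obj ((Ψ.app a ⋙ D'.pathFunctor (F.mapPath p)).obj x) by
        rw [Prefunctor.mapPath_cons, pathFunctor_cons]; rfl) ≫
        (D'.map (F.map e)).map ((Ψ.pathIso p).hom.app x) ≫ (Ψ.iso e).hom.app ((D.pathFunctor p).obj x) ≫
        eqToHom (show (D.map e ⋙ Ψ.app c).obj ((D.pathFunctor p).obj x) = (D.pathFunctor (p.cons e) ⋙ Ψ.app c).obj x by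
          rw [pathFunctor_cons]; rfl) := by
  rw [pathIso_cons]
  simp only [Iso.trans_hom, eqToIso.hom, NatTrans.comp_app, eqToHom_app, Iso.symm_hom,
    Functor.associator_inv_app, Functor.associator_hom_app, Functor.isoWhiskerRight_hom,
    Functor.isoWhiskerLeft_hom, Functor.whiskerRight_app, Functor.whiskerLeft_app, Category.assoc]
  erw [Category.id_comp, Category.id_comp, Category.id_comp]
  rfl

/-- naturality of `Ψ_{[γ]}`. [cite: MochizukiAbsTopIII2015, Definition 3.5 (v) p.76] -/
@[reassoc]
theorem pathIso_hom_naturality {a b : V} (p : Path a b) {x y : D.obj a} (f : x ⟶ y) :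
    (D'.pathFunctor (F.mapPath p)).map ((Ψ.app a).map f) ≫ (Ψ.pathIso p).hom.app y =
      (Ψ.pathIso p).hom.app x ≫ (Ψ.app b).map ((D.pathFunctor p).map f) :=
  (Ψ.pathIso p).hom.naturality f

/-! ### Heterogeneous forms (the path functors satisfy `𝒟_{[σ∘γ]} = 𝒟_{[σ]} ∘ 𝒟_{[γ]}` only propositionally) -/

/-- components of `Ψ_{[γ]}` on the empty path are identities, heterogeneously.
[cite: MochizukiAbsTopIII2015, Definition 3.5 (v) p.76] -/
theorem pathIso_nil_heq (a : V) (x : D.obj a) :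
    HEq ((Ψ.pathIso (Path.nil : Path a a)).hom.app x) (𝟙 ((Ψ.app a).obj x)) := by
  rw [pathIso_nil_hom_app]
  exact heq_id_of_eq _ (by simp only [Functor.comp_obj, Prefunctor.mapPath_nil, pathFunctor_nil, Functor.id_obj])

/-- components of `Ψ_{[γ]}` on an extended path, heterogeneously: `𝒟'_{F e}(Ψ_{[γ]}) ≫ Ψ_e`.
[cite: MochizukiAbsTopIII2015, Definition 3.5 (v) p.76] -/
theorem pathIso_cons_heq {a b c : V} (p : Path a b) (e : b ⟶ c) (x : D.obj a) :
    HEq ((Ψ.pathIso (p.cons e)).hom.app x)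
      ((D'.map (F.map e)).map ((Ψ.pathIso p).hom.app x) ≫ (Ψ.iso e).hom.app ((D.pathFunctor p).obj x)) := by
  rw [pathIso_cons_hom_app]
  simp only [eqToHom_comp_heq_iff]
  exact heq_comp rfl rfl (by simp only [Functor.comp_obj, pathFunctor_cons]) HEq.rfl (comp_eqToHom_heq _ _)

/-- `Ψ_{[γ]}` along a composite path, heterogeneously: `Ψ_{[σ∘γ]} = (𝒟'_{F σ} ◁ Ψ_{[γ]}) ≫ (Ψ_{[σ]} ▷ 𝒟_{[γ]})`.
[cite: MochizukiAbsTopIII2015, Definition 3.5 (v) p.76] -/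
theorem pathIso_comp_heq {a b c : V} (r : Path a b) (s : Path b c) (x : D.obj a) :
    HEq ((Ψ.pathIso (r.comp s)).hom.app x)
      ((D'.pathFunctor (F.mapPath s)).map ((Ψ.pathIso r).hom.app x) ≫ (Ψ.pathIso s).hom.app ((D.pathFunctor r).obj x)) := by
  induction s with
  | nil =>
    change HEq ((Ψ.pathIso r).hom.app x) _
    refine HEq.symm ((heq_comp (Z' := (D.pathFunctor r ⋙ Ψ.app b).obj x)
      (by simp only [Functor.comp_obj, Prefunctor.mapPath_nil, pathFunctor_nil, Functor.id_obj])
      (by simp only [Functor.comp_obj, Prefunctor.mapPath_nil, pathFunctor_nil, Functor.id_obj])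
      (by simp only [Functor.comp_obj, pathFunctor_nil, Functor.id_obj])
      ((Functor.hcongr_hom (show D'.pathFunctor (F.mapPath (Path.nil : Path b b)) = 𝟭 _ by
        rw [Prefunctor.mapPath_nil, pathFunctor_nil]) ((Ψ.pathIso r).hom.app x)).trans (heq_of_eq (Functor.id_map _)))
      (Ψ.pathIso_nil_heq b ((D.pathFunctor r).obj x))).trans (heq_of_eq (by erw [Category.comp_id])))
  | cons s e ih =>
    change HEq ((Ψ.pathIso ((r.comp s).cons e)).hom.app x) _
    refine (Ψ.pathIso_cons_heq (r.comp s) e x).trans ?_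
    -- both sides ≍ `𝒟'_{Fe}(𝒟'_{Fσ}(Ψ_{[γ]})) ≫ 𝒟'_{Fe}(Ψ_{[σ]}) ≫ Ψ_e`
    have h₁ : HEq ((D'.map (F.map e)).map ((Ψ.pathIso (r.comp s)).hom.app x))
        ((D'.map (F.map e)).map ((D'.pathFunctor (F.mapPath s)).map ((Ψ.pathIso r).hom.app x) ≫
          (Ψ.pathIso s).hom.app ((D.pathFunctor r).obj x))) :=
      map_heq _ (by simp only [Functor.comp_obj, Prefunctor.mapPath_comp, pathFunctor_comp])
        (by simp only [Functor.comp_obj, pathFunctor_comp]) ih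
    have h₂ : HEq ((Ψ.iso e).hom.app ((D.pathFunctor (r.comp s)).obj x))
        ((Ψ.iso e).hom.app ((D.pathFunctor s).obj ((D.pathFunctor r).obj x))) :=
      app_heq _ (by simp only [Functor.comp_obj, pathFunctor_comp])
    refine (heq_comp (by simp only [Functor.comp_obj, Prefunctor.mapPath_comp, pathFunctor_comp])
      (by simp only [Functor.comp_obj, pathFunctor_comp]) (by simp only [Functor.comp_obj, pathFunctor_comp])
      h₁ h₂).trans ?_
    erw [Functor.map_comp, Category.assoc]
    refine HEq.symm (heq_comp (by simp only [Functor.comp_obj, Prefunctor.mapPath_cons, pathFunctor_cons])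
      (by simp only [Functor.comp_obj, Prefunctor.mapPath_cons, pathFunctor_cons])
      (by simp only [Functor.comp_obj, pathFunctor_cons])
      (Functor.hcongr_hom (show D'.pathFunctor (F.mapPath (s.cons e)) = D'.pathFunctor (F.mapPath s) ⋙ D'.map (F.map e)
        by rw [Prefunctor.mapPath_cons, pathFunctor_cons]) _)
      (Ψ.pathIso_cons_heq s e ((D.pathFunctor r).obj x)))

end OneMorphism

/-! ### 1-morphisms lying over a functor of the bases -/

/-- **`Ψ` lies over `Φ`**: for a 1-morphism `Ψ : 𝒟 → 𝒟'` over the graph morphism `F`, structure functors `O = (N, μ)` of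
`𝒟` over `𝒞` and `O' = (N', μ')` of `𝒟'` over `𝒞'`, and a functor `Φ : 𝒞 ⥤ 𝒞'`: isomorphisms
`θ_v : Ψ_v ⋙ N'_{F v} ≅ N_v ⋙ Φ` such that, for every edge `e : v₁ ⟶ v₂`, the PRISM formed by `Ψ_e`, `θ_{v₂}`, `μ_e` and
`μ'_{F e}`, `θ_{v₁}` commutes (componentwise: `N'(Ψ_e) ≫ θ_{v₂} ≫ Φ(μ_e) = μ'_{F e} ≫ θ_{v₁}`).  The evident notion of a
1-morphism compatible with the "constant portions" (Rmk. 3.5.1) exhibited by the structure functors.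
[cite: MochizukiAbsTopIII2015, Remark 3.5.1 p.78] -/
structure OneMorphism.OverHom (Ψ : OneMorphism F D D') {C : Type u} [Category.{v} C] {C' : Type u} [Category.{v} C']
    (O : D.OverData C) (O' : D'.OverData C') (Φ : C ⥤ C') : Type (max u v w) where
  /-- `θ_v : Ψ_v ⋙ N'_{F v} ≅ N_v ⋙ Φ` -/
  θ : ∀ a : V, Ψ.app a ⋙ O'.N (F.obj a) ≅ O.N a ⋙ Φ
  /-- the prism at the edge `e`, componentwise -/
  prism : ∀ {a b : V} (e : a ⟶ b) (x : D.obj a),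
    (O'.N (F.obj b)).map ((Ψ.iso e).hom.app x) ≫ (θ b).hom.app ((D.map e).obj x) ≫ Φ.map ((O.μ e).hom.app x) =
      (O'.μ (F.map e)).hom.app ((Ψ.app a).obj x) ≫ (θ a).hom.app x

namespace OneMorphism.OverHom

variable {Ψ : OneMorphism F D D'} {C : Type u} [Category.{v} C] {C' : Type u} [Category.{v} C']
  {O : D.OverData C} {O' : D'.OverData C'} {Φ : C ⥤ C'} (H : Ψ.OverHom O O' Φ)

/-- **the prisms compose along paths**: `N'(Ψ_{[γ]}) ≫ θ_b ≫ Φ(pathIso γ) = pathIso' (F γ) ≫ θ_a`, componentwise.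
[cite: MochizukiAbsTopIII2015, Definition 3.5 (v) p.76] -/
theorem pathPrism {a b : V} (p : Path a b) (x : D.obj a) :
    (O'.N (F.obj b)).map ((Ψ.pathIso p).hom.app x) ≫ (H.θ b).hom.app ((D.pathFunctor p).obj x) ≫
        Φ.map ((O.pathIso p).hom.app x) =
      (O'.pathIso (F.mapPath p)).hom.app ((Ψ.app a).obj x) ≫ (H.θ a).hom.app x := by
  induction p with
  | nil =>
    -- both sides ≍ `θ_a x`
    refine heq_iff_eq.mp ?_
    have h₁ : HEq ((O'.N (F.obj a)).map ((Ψ.pathIso (Path.nil : Path a a)).hom.app x))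
        (𝟙 ((O'.N (F.obj a)).obj ((Ψ.app a).obj x))) :=
      (map_heq (O'.N (F.obj a)) (by simp only [Functor.comp_obj, Prefunctor.mapPath_nil, pathFunctor_nil, Functor.id_obj])
        (by simp only [Functor.comp_obj, pathFunctor_nil, Functor.id_obj]) (Ψ.pathIso_nil_heq a x)).trans
        (heq_of_eq ((O'.N (F.obj a)).map_id _))
    have h₂ : HEq ((H.θ a).hom.app ((D.pathFunctor (Path.nil : Path a a)).obj x)) ((H.θ a).hom.app x) :=
      app_heq (H.θ a).hom (by simp only [pathFunctor_nil, Functor.id_obj])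
    have h₃ : HEq (Φ.map ((O.pathIso (Path.nil : Path a a)).hom.app x)) (𝟙 (Φ.obj ((O.N a).obj x))) :=
      (map_heq Φ (by simp only [Functor.comp_obj, pathFunctor_nil, Functor.id_obj]) rfl (O.pathIso_nil_heq a x)).trans
        (heq_of_eq (Φ.map_id _))
    have h₄ : HEq ((O'.pathIso (F.mapPath (Path.nil : Path a a))).hom.app ((Ψ.app a).obj x))
        (𝟙 ((O'.N (F.obj a)).obj ((Ψ.app a).obj x))) :=
      O'.pathIso_nil_heq (F.obj a) ((Ψ.app a).obj x)
    have hL := heq_comp (by simp only [Functor.comp_obj, Prefunctor.mapPath_nil, pathFunctor_nil, Functor.id_obj])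
      (by simp only [Functor.comp_obj, pathFunctor_nil, Functor.id_obj]) rfl h₁
      (heq_comp (by simp only [Functor.comp_obj, pathFunctor_nil, Functor.id_obj])
        (by simp only [Functor.comp_obj, pathFunctor_nil, Functor.id_obj]) rfl h₂ h₃)
    have hR : HEq ((O'.pathIso (F.mapPath (Path.nil : Path a a))).hom.app ((Ψ.app a).obj x) ≫ (H.θ a).hom.app x)
        (𝟙 ((O'.N (F.obj a)).obj ((Ψ.app a).obj x)) ≫ (H.θ a).hom.app x) :=
      heq_comp (by simp only [Functor.comp_obj, Prefunctor.mapPath_nil, pathFunctor_nil, Functor.id_obj]) rfl rfl h₄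
        (HEq.refl ((H.θ a).hom.app x))
    refine hL.trans (HEq.trans (heq_of_eq ?_) hR.symm)
    erw [Category.id_comp, Category.id_comp, Category.comp_id]
  | cons p e ih =>
    have hp := H.prism e ((D.pathFunctor p).obj x)
    have hn := (O'.μ (F.map e)).hom.naturality ((Ψ.pathIso p).hom.app x)
    refine heq_iff_eq.mp ?_
    -- LHS ≍ `(N'(𝒟'_{Fe} Ψ_{[γ]}) ≫ N'(Ψ_e)) ≫ θ_c ≫ Φ(μ_e) ≫ Φ(pathIso γ)`
    have h₁ : HEq ((O'.N (F.obj _)).map ((Ψ.pathIso (p.cons e)).hom.app x))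
        ((O'.N (F.obj _)).map ((D'.map (F.map e)).map ((Ψ.pathIso p).hom.app x)) ≫
          (O'.N (F.obj _)).map ((Ψ.iso e).hom.app ((D.pathFunctor p).obj x))) :=
      (map_heq (O'.N (F.obj _)) (by simp only [Functor.comp_obj, Prefunctor.mapPath_cons, pathFunctor_cons])
        (by simp only [Functor.comp_obj, pathFunctor_cons]) (Ψ.pathIso_cons_heq p e x)).trans
        (heq_of_eq ((O'.N (F.obj _)).map_comp _ _))
    have h₂ := app_heq (H.θ _).hom
      (show (D.pathFunctor (p.cons e)).obj x = (D.map e).obj ((D.pathFunctor p).obj x) by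
        simp only [pathFunctor_cons, Functor.comp_obj])
    have h₃ : HEq (Φ.map ((O.pathIso (p.cons e)).hom.app x))
        (Φ.map ((O.μ e).hom.app ((D.pathFunctor p).obj x)) ≫ Φ.map ((O.pathIso p).hom.app x)) :=
      (map_heq Φ (by simp only [Functor.comp_obj, pathFunctor_cons]) rfl (O.pathIso_cons_heq p e x)).trans
        (heq_of_eq (Φ.map_comp _ _))
    have hL := heq_comp (by simp only [Functor.comp_obj, Prefunctor.mapPath_cons, pathFunctor_cons])
      (by simp only [Functor.comp_obj, pathFunctor_cons]) rfl h₁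
      (heq_comp (by simp only [Functor.comp_obj, pathFunctor_cons]) (by simp only [Functor.comp_obj, pathFunctor_cons])
        rfl h₂ h₃)
    -- RHS ≍ `(μ'_{Fe} ≫ pathIso' (Fγ)) ≫ θ_a`
    have h₄ : HEq ((O'.pathIso (F.mapPath (p.cons e))).hom.app ((Ψ.app a).obj x))
        ((O'.μ (F.map e)).hom.app ((D'.pathFunctor (F.mapPath p)).obj ((Ψ.app a).obj x)) ≫
          (O'.pathIso (F.mapPath p)).hom.app ((Ψ.app a).obj x)) :=
      O'.pathIso_cons_heq (F.mapPath p) (F.map e) ((Ψ.app a).obj x)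
    have hR : HEq ((O'.pathIso (F.mapPath (p.cons e))).hom.app ((Ψ.app a).obj x) ≫ (H.θ a).hom.app x)
        (((O'.μ (F.map e)).hom.app ((D'.pathFunctor (F.mapPath p)).obj ((Ψ.app a).obj x)) ≫
          (O'.pathIso (F.mapPath p)).hom.app ((Ψ.app a).obj x)) ≫ (H.θ a).hom.app x) :=
      heq_comp (by simp only [Functor.comp_obj, Prefunctor.mapPath_cons, pathFunctor_cons]) rfl rfl h₄
        (HEq.refl ((H.θ a).hom.app x))
    exact hL.trans ((heq_of_eq (prism_cons_calc hp hn ih)).trans hR.symm)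

end OneMorphism.OverHom

end DiagramOfCategories

end Literature.AnabelianGeometry.AbsoluteAnabelian

end
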